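import Summits.QuantumFields.YangMills.Theorems.DressedRitz.Negative.RawVacuumLoadBearing
import Summits.QuantumFields.YangMills.Theorems.LuscherReductionDressedRitzPolyakovLiftDressed
import HarnessLib

/-!
# Crux `DressedRitz` (stmt-QuantumFields-20205), line «polyakovlift» SKELETON r3 (11209be61e7d2ff5, time-dressed lift) — the normalisation
# `⟨φ,φ⟩ = 1` of `IsRawVacuum` stays LOAD-BEARING for S-STAT and invisible to S-POS-core ∕ S-LEAK (dressed twin of `RawVacuumLoadBearing.lean`)

Standing crux disprover `ym-cdisprove-20205-1` g1 (refuter), supporting item stmt-QuantumFields-20205 (no verdict change).  Skeleton r3 replaced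
`liftFamily` by `dressedLiftFamily β φ g i = K_β^[dressSteps L] (liftVec β φ (g i))` in all three stub texts (lead's HAZARD-S-LEAK-UV: the sharp-time
lift violates (o4) at one loop; time-dressing repairs it).  The φ-slot analysis of the r2 file transfers verbatim because the dressing is linear
and `K_β 0 = 0`:

* `dressedLiftFamily_zeroVac` — over the zero vacuum the dressed family is the zero family;
* `dynamicCoreClauses_dressedLiftFamily_zeroVac`, `leakageClause_dressedLiftFamily_zeroVac` — the r3 bodies of S-POS-core and S-LEAK hold there with
  EVERY constant (they cannot see the normalisation);
* `not_staticClauses_dressedLiftFamily_zeroVac` — (o0) of S-STAT fails there for `k ≥ 1`;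
* ★ `liftStaticsR3_false_without_normalisation` — the registered r3 text of `stub_liftStatics` with `IsRawVacuum β φ` weakened to
  `IsPhys φ ∧ K_βφ = λ₀φ` is FALSE (witness: `k = 1`, `lam = min lam0 1`, `L = L0+1`, a window `β`, the zero vacuum, any lift basis).
  Any proof of r3 S-STAT must use `⟨φ,φ⟩ = 1` (in the tree: `PolyakovLift.dressedLiftFamily_o0` does, through `rawVacuum_ne_zero`).

HONEST FRAMING: hypothesis bookkeeping at fixed lattice on the CONDITIONAL femto rung R2b1; nothing here bears on infinite volume, the continuum
limit or the Clay mass gap.  [folklore]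
-/

set_option autoImplicit false

noncomputable section

open MeasureTheory Filter Topology Real
open Literature.MathematicalPhysics.QuantumFieldTheory
open Literature.MathematicalPhysics.QuantumLattice

namespace Summit.QuantumFields.YangMills.Theorems.FemtoTransferGap.PolyakovLift.Negative

open Summit.QuantumFields.YangMills.Theorems.FemtoTransferGap
open Summit.QuantumFields.YangMills.Theorems.FemtoTransferGap.PolyakovLift

section ZeroVacDressed

variable {L : ℕ} [NeZero L]

/-- `K_β^[m] 0 = 0`. [folklore] -/
theorem iterate_transferApply_zeroVec (β : ℝ) (m : ℕ) :
    (transferApply (L := L) β)^[m] (fun _ => (0 : ℝ)) = fun _ => 0 :=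
  Function.iterate_fixed (transferApply_zeroVec (L := L) β) m

/-- Over the zero vacuum every DRESSED lifted vector vanishes. [folklore] -/
theorem dressedLiftVec_zeroVac (β : ℝ) (g : GaugeConfig 3 1 SU2 → ℝ) :
    dressedLiftVec β (fun _ : GaugeConfig 3 L SU2 => (0 : ℝ)) g = fun _ => 0 := by
  unfold dressedLiftVec liftVec
  rw [ins_zeroVac, iterate_transferApply_zeroVec]

/-- Over the zero vacuum the dressed lifted family is the zero family. [folklore] -/
theorem dressedLiftFamily_zeroVac (β : ℝ) {k : ℕ} (g : Fin k → (GaugeConfig 3 1 SU2 → ℝ)) :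
    dressedLiftFamily β (fun _ : GaugeConfig 3 L SU2 => (0 : ℝ)) g = fun _ _ => 0 := by
  funext i
  simp only [dressedLiftFamily, dressedLiftVec_zeroVac]

/-- ★ The r3 body of S-POS-core ((o5) ∧ (o6)) holds for the dressed lift of ANY basis over the zero vacuum, with every `C`. [folklore] -/
theorem dynamicCoreClauses_dressedLiftFamily_zeroVac (k : ℕ) (C β : ℝ) (g : Fin k → (GaugeConfig 3 1 SU2 → ℝ)) :
    DynamicCoreClauses k C β (dressedLiftFamily β (fun _ : GaugeConfig 3 L SU2 => (0 : ℝ)) g) := by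
  rw [dressedLiftFamily_zeroVac]
  exact dynamicCoreClauses_zeroFamily k C β

/-- ★ The r3 body of S-LEAK ((o4)) holds for the dressed lift of ANY basis over the zero vacuum, with every `C`. [folklore] -/
theorem leakageClause_dressedLiftFamily_zeroVac (k : ℕ) (C β : ℝ) (g : Fin k → (GaugeConfig 3 1 SU2 → ℝ)) :
    LeakageClause k C β (dressedLiftFamily β (fun _ : GaugeConfig 3 L SU2 => (0 : ℝ)) g) := by
  rw [dressedLiftFamily_zeroVac]
  exact leakageClause_zeroFamily k C β

/-- ★ … whereas (o0) of the r3 S-STAT body fails there as soon as `k ≥ 1`. [folklore] -/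
theorem not_staticClauses_dressedLiftFamily_zeroVac {k : ℕ} (hk : 0 < k) (C β : ℝ) (g : Fin k → (GaugeConfig 3 1 SU2 → ℝ)) :
    ¬ StaticClauses k C β (dressedLiftFamily β (fun _ : GaugeConfig 3 L SU2 => (0 : ℝ)) g) := by
  rw [dressedLiftFamily_zeroVac]
  rintro ⟨h0, -⟩
  have h := h0 ⟨0, hk⟩
  simp [l2_zeroVec_left] at h

end ZeroVacDressed

/-- ★★ **r3 S-STAT WITHOUT THE NORMALISATION is false — any proof of the r3 `stub_liftStatics` must use `⟨φ,φ⟩ = 1`.**  The negated statement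
is the registered r3 text (skeleton 11209be61e7d2ff5) VERBATIM except that `IsRawVacuum β φ` is weakened to `IsPhys φ ∧ K_βφ = λ₀φ`.  Witness:
`k = 1`, `lam = min lam0 1`, `L = L0 + 1`, a window `β` (`TwistedTraceScaling.Negative.exists_inFemtoWindow`), the zero vacuum, any lift basis at
`B₁ = 2/λ³ > 0` (`exists_liftBasis`); (o0) reads `0 < 0`. [folklore] -/
theorem liftStaticsR3_false_without_normalisation :
    ¬ (∀ k : ℕ, ∃ C lam0 : ℝ, 0 ≤ C ∧ 0 < lam0 ∧ ∀ lam : ℝ, 0 < lam → lam ≤ lam0 → ∃ L0 : ℕ,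
        ∀ (L : ℕ) [NeZero L], L0 ≤ L → ∀ β : ℝ, InFemtoWindow lam β L →
          ∀ φ : GaugeConfig 3 L SU2 → ℝ, IsPhys φ → transferApply β φ = levelValue su2Rep L β 0 • φ →
            ∀ (ω : GaugeConfig 3 1 SU2 → ℝ) (g : Fin k → (GaugeConfig 3 1 SU2 → ℝ)), LiftBasis (liftCoupling β L) k ω g →
              StaticClauses k C β (dressedLiftFamily β φ g)) := by
  intro h
  obtain ⟨C, lam0, -, hlam0, H⟩ := h 1
  have hlam : 0 < min lam0 1 := lt_min hlam0 one_pos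
  obtain ⟨L0, HL⟩ := H (min lam0 1) hlam (min_le_left _ _)
  obtain ⟨β, hW, hval⟩ :=
    Summit.QuantumFields.YangMills.Theorems.TwistedTraceScaling.Negative.exists_inFemtoWindow (L0 + 1) hlam (min_le_right _ _)
  have hB : 0 < liftCoupling β (L0 + 1) := by
    unfold liftCoupling
    rw [hval]
    positivity
  obtain ⟨ω, g, hbasis⟩ := exists_liftBasis hB 1
  have hS := HL (L0 + 1) (Nat.le_succ _) β hW (fun _ => (0 : ℝ)) (isPhys_const 0) (zeroVec_eigen β) ω g hbasis
  exact not_staticClauses_dressedLiftFamily_zeroVac one_pos C β g hS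

/-- The registered r3 S-STAT text implies the mutated one on normalised vacua: the mutation deletes exactly the clause `⟨φ,φ⟩ = 1`
(pointer: `isRawVacuum_iff`).  Conversely the tree's `PolyakovLift.dressedLiftFamily_o0` proves (o0) FROM `IsRawVacuum` — so the deleted
clause is both necessary (this file) and, for (o0), sufficient (tree). [folklore] -/
theorem staticClauses_o0_iff_of_zeroVac {L : ℕ} [NeZero L] {k : ℕ} (hk : 0 < k) (C β : ℝ) (g : Fin k → (GaugeConfig 3 1 SU2 → ℝ)) :
    StaticClauses k C β (dressedLiftFamily β (fun _ : GaugeConfig 3 L SU2 => (0 : ℝ)) g) ↔ False :=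
  ⟨not_staticClauses_dressedLiftFamily_zeroVac hk C β g, False.elim⟩

end Summit.QuantumFields.YangMills.Theorems.FemtoTransferGap.PolyakovLift.Negative

end
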